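import Summits.BirchSwinnertonDyer.BirchSwinnertonDyer.Theorems.ManinLocalTwoThreeManinPrimeToAdditiveFiveLeBistarredKodaira
import Summits.BirchSwinnertonDyer.BirchSwinnertonDyer.Theorems.ManinLocalTwoThreeManinPrimeToAdditiveFiveLeTypeIIAtFiveCornerOfUnstarredLaw
import Summits.BirchSwinnertonDyer.BirchSwinnertonDyer.Theorems.KatoDescentTamePotSupersingularTameDefectIsogenyInvariance
import Summits.BirchSwinnertonDyer.Rank1Residual.ManinAdditive.OptimalUnstarredAcrossIsogeny
import Summits.BirchSwinnertonDyer.Rank1Residual.LW16.IsogenyKummerDegenerationReducible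
import Literature.NumberTheory.EllipticCurves.IsogenyNeronScalarPotSupersingular
import Literature.NumberTheory.EllipticCurves.PastenHeightBoundsIsogenyProofs
import Literature.NumberTheory.EllipticCurves.NeronIsogenyScalingHoldsProofs
import Literature.NumberTheory.EllipticCurves.IsogenyVariableChangeProofs
import Literature.NumberTheory.EllipticCurves.IsogenyCompProofs
import HarnessLib

/-!
# Route `ManinLocalTwoThree`, residual crux C5 `ManinPrimeToAdditiveFiveLe`
# (stmt-BirchSwinnertonDyer-22969), line `upper_anchor` (skeleton v8, registered stub
# `stub_optimalUnstarredNonGord57`): **law (U) «optimal ⟹ unstarred» IS the cell's registered conjecture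
# E-imc-5 `OptimalUnstarredAcrossIsogeny p` at `p ∈ {5, 7}`, granted Gealy–Klagsbrun 2017**

Width seat bsd-line-ml23-c5-p1-w2 (gen 4), piece υ. Skeleton v8 of the line (`Cruxes/ManinPrimeToAdditiveFiveLe/Lines/
upper_anchor.lean`, sha16 f41b6313bdbd3fbd) has the Manin-free, degree-free stub U
`stub_optimalUnstarredNonGord57` («a lattice-optimal, `W[p]`-reducible, globally twist-minimal curve with
`p² ∣ N > 5·10⁵`, no `Iₙ*` fibre and NOT (G)-ordinary at `p ∈ {5,7}` is unstarred, `ord_p Δ_min ≤ 4`»), on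
which BOTH corners of RED(57♯) ride (λ p621355, μ p623176). This file shows that U is NOT a new open
statement of the cell: it is a COROLLARY of the imc planner's registered, refuter-vetted `@[conjecture]`
E-imc-5 `Summit.BirchSwinnertonDyer.Rank1Residual.ManinAdditive.OptimalUnstarredAcrossIsogeny` («for
`p ≥ 5`, the `X₀`-optimal curve is never the starred end of a rational `p`-isogeny facing an unstarred
end»; REF1 SURVIVES 2026-08-27T14:02Z, 0 / 650 exceptions, `Summits/…/ManinAdditive/OptimalUnstarredAcrossIsogeny.lean`)
together with ONE printed input, Gealy–Klagsbrun 2017 Thm. 1 (tree cite-only fact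
`gealyKlagsbrun2017_neronScalar_of_additive_potSupersingular`: at an additive potentially SUPERSINGULAR
`p` a rational `p`-isogeny changes `ord_p Δ_min`).

* §1 `padicValInt_le_four_of_acrossIsogeny_of_gealyKlagsbrun` — the one-prime kernel: `W` globally
  minimal with a lattice-optimal conductor-level datum, `p ≥ 5`, `p² ∣ N(W)`, `W[p]` reducible, no `Iₙ*`
  fibre at `p`, NOT (G)-ordinary at `p` ⟹ `ord_p Δ_min(W) ≤ 4`, GIVEN E-imc-5 at `p` and Gealy–Klagsbrun.
  Proof: if `W` were starred (`ord_p Δ_min ∈ {8, 9, 10}`, `ord_p j ≥ 0`), the rational `p`-isogeny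
  `W → W₂` (reducibility, `exists_isogeny_comp_eq_prime_smul_of_not_irreducible`; `W₂` made globally
  minimal by `hasGlobalMinimalModel_rat_holds` and the degree-one isogeny `VariableChange.toIsogeny`) acts
  on the Néron lattices as `z ↦ kz`, `k ∈ ℤ`, with index `p` (`exists_rat_mulLeft_lattice_le_of_isogeny`,
  `integral_neronScaling_of_isGloballyMinimal_holds`); not (G)-ordinary = not potentially good ordinary
  (`typeGOrd_iff_exists_good_unitRoot`), so Gealy–Klagsbrun gives `ord_p Δ_min(W₂) ≠ ord_p Δ_min(W)`, and
  the PROVED tame-defect invariance `gcd(12, ord_p Δ_min(W₂)) = gcd(12, ord_p Δ_min(W))`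
  (`TameDefectIsogenyInvariance`) forces `ord_p Δ_min(W₂) = 12 − ord_p Δ_min(W) ≤ 4 < 6`; E-imc-5 then
  says `ord_p Δ_min(W) < 6` — contradiction.
* §2 `optimalUnstarredNonGord57_of_acrossIsogeny_of_gealyKlagsbrun` — **stub U VERBATIM ⟸
  Gealy–Klagsbrun ∧ `OptimalUnstarredAcrossIsogeny 5` ∧ `OptimalUnstarredAcrossIsogeny 7`** (its
  twist-minimality and `N > 5·10⁵` binders are idle).
* §3 `typeIIAtFiveCorner_of_acrossIsogeny`, `red57bistarred_of_dokchitser_of_acrossIsogeny` — the two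
  v8 corners (hypotheses `hB` of p622240 and of p617914, verbatim) modulo {E-imc-5 at 5, 7; GK; D–D}.

Net effect on the line's ledger: the v8 residual {ANCHOR, U, DegreeUp13Red} reads {ANCHOR, E-imc-5(5) ∧
E-imc-5(7), DegreeUp13Red} — one refuter target fewer (U and E-imc-5 were filed by two seats of the cell as
independent laws). HONEST STATUS: conditional-result helpers (`--supports … --as helper`): E-imc-5 is an
OPEN conjecture of the cell (not in print), Gealy–Klagsbrun is a cite-only printed fact; nothing here proves
BSD, Manin's conjecture, E-imc-5 or C5.

References: [GealyKlagsbrun2017] M. Gealy, Z. Klagsbrun, arXiv:1703.02148, Thm. 1; [DokchitserDokchitser2015LocalInvariants]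
Trans. AMS 367 (2015), Table 1, Cor. 3.3, Thm. 5.1 (1); [SilvermanAEC2009] Prop. VII.5.1, Cor. VII.7.2, Thm. VI.4.1(b);
[SilvermanATAEC1994] IV Table 4.1, IV.5.1/IV.6.1/Cor. IV.9.1 (Néron mapping property); [Serre1972] §5.6;
[EdixhovenManin1991] §4 (twist table); cell bsd-f2-manin MEMO-imc.md §3 (IMC-O, E-imc-5).
-/

set_option autoImplicit false
-- the Theorems namespace of this sub repeats the summit name by design (D-0017 nested layout)
set_option linter.dupNamespace false

noncomputable section

open scoped Classical NumberField

namespace Summit.BirchSwinnertonDyer.BirchSwinnertonDyer.Theorems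

open WeierstrassCurve IsDedekindDomain IsDedekindDomain.HeightOneSpectrum Rat.HeightOneSpectrum NumberField
  Literature.NumberTheory.EllipticCurves Literature.NumberTheory.EllipticCurves.ModularForms
  Literature.NumberTheory.EllipticCurves.Rank1Residual
  Summit.BirchSwinnertonDyer.Rank1Residual.ManinAdditive
  Summit.BirchSwinnertonDyer.Rank1Residual.Additive
  Summit.BirchSwinnertonDyer.BirchSwinnertonDyer.Theses.EdixhovenFibreFiveSeven

/-! ## §1 The one-prime kernel: E-imc-5 ∧ Gealy–Klagsbrun ⟹ «optimal, reducible, not (G)-ordinary ⟹ unstarred» -/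

/-- **«Optimal ⟹ unstarred» on the potentially supersingular `W[p]`-reducible locus at an additive `p ≥ 5`,
from E-imc-5 and Gealy–Klagsbrun.** `hGK`: the cite-only transcription of [GealyKlagsbrun2017, Thm. 1] (a
rational `p`-isogeny out of an additive potentially supersingular curve changes `ord_p Δ_min`). `hE`: the
cell's conjecture E-imc-5 `OptimalUnstarredAcrossIsogeny p` (an OPEN law, taken as a hypothesis). For `W`
globally minimal with a lattice-optimal conductor-level datum `D`, `p² ∣ N(W)`, `W[p]` reducible, no `Iₙ*` fibre
at `p` and NOT (G)-ordinary at `p`: `ord_p Δ_min(W) ≤ 4`. (A starred `W` would have `ord_p j ≥ 0`,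
`ord_p Δ_min ∈ {8,9,10}`; its rational `p`-isogeny `W → W₂` acts on Néron lattices by an integer of index `p`,
Gealy–Klagsbrun and the tame-defect invariance put `W₂` at `12 − ord_p Δ_min(W) < 6`, and E-imc-5 forbids
exactly this.) Conditional result; closes nothing.
[cite: GealyKlagsbrun2017, Thm. 1] [cite: SilvermanAEC2009, Thm. VI.4.1(b) and Cor. VII.7.2]
[cite: SilvermanATAEC1994, IV Table 4.1] -/
theorem padicValInt_le_four_of_acrossIsogeny_of_gealyKlagsbrun
    (hGK : gealyKlagsbrun2017_neronScalar_of_additive_potSupersingular)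
    {p : ℕ} [hp : Fact p.Prime] (hp5 : 5 ≤ p) (hE : OptimalUnstarredAcrossIsogeny p)
    (W : WeierstrassCurve ℚ) [W.IsElliptic] [W.IsGloballyMinimal] [NeZero (W.conductorNorm ℤ)]
    (D : ModularParametrizationData W (W.conductorNorm ℤ)) (hD : IsLatticeOptimal D)
    (hpN : p ^ 2 ∣ W.conductorNorm ℤ) (hred : ¬ W.HasIrreducibleModPGaloisRep p)
    (hI : ∀ n : ℕ, W.kodairaSymbolAt (placeOf p) ≠ .Istar n) (hG : ¬ TypeGOrd W p) :
    padicValInt p W.minimalDiscriminantInt ≤ 4 := by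
  by_contra hv4
  have hv : 4 < padicValInt p W.minimalDiscriminantInt := by omega
  have hadd : Addv W p := not_good_and_not_mult_of_sq_dvd_conductorNorm W hpN
  obtain ⟨hj, hmem⟩ := padicValRat_j_nonneg_and_mem_of_starred W p hp5 hadd hI hv
  -- not (G)-ordinary = not potentially good ordinary (the tree's dictionary at an additive `p ≥ 5`)
  have hnpo : ¬ W.HasPotentiallyGoodOrdinaryReductionAtPrime p := fun h ↦
    hG ((typeGOrd_iff_exists_good_unitRoot W p hp5 hadd).mpr
      ((W.hasPotentiallyGoodOrdinaryReductionAtPrime_iff p).mp h))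
  -- the rational `p`-isogeny given by reducibility, with a globally minimal target `W₂`
  obtain ⟨W', hE', φ, -, hdeg, -, -⟩ :=
    Summit.BirchSwinnertonDyer.Rank1Residual.LW16.IsogenyEdge.exists_isogeny_comp_eq_prime_smul_of_not_irreducible
      W hred
  haveI := hE'
  obtain ⟨C, hCmin⟩ := hasGlobalMinimalModel_rat_holds W'
  haveI : (C • W').IsGloballyMinimal := hCmin
  set φ₂ : Isogeny W (C • W') := (VariableChange.toIsogeny W' C).comp φ with hφ₂
  have hdeg₂ : φ₂.degree = p := by
    rw [← hdeg]
    unfold Isogeny.degree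
    rw [hφ₂, Isogeny.ker_comp, VariableChange.ker_toIsogeny, AddMonoidHom.comap_bot]
  have hiso : IsIsogenous W (C • W') := ⟨φ₂⟩
  -- Néron lattices and the integer multiplier of index `p`
  haveI : ((C • W').baseChange ℂ).IsElliptic := by rw [WeierstrassCurve.baseChange]; infer_instance
  obtain ⟨L₂, hL₂⟩ := exists_isNeronLatticeOf_holds ((C • W').baseChange ℂ)
  obtain ⟨q, hq, hle, hidx⟩ := exists_rat_mulLeft_lattice_le_of_isogeny W (C • W') D.isNeronLattice hL₂ φ₂
  have hqmem : ∀ z ∈ D.L.lattice, ((q : ℚ) : ℂ) * z ∈ L₂.lattice := fun z hz ↦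
    hle (PeriodPair.mul_mem_mulLeft_lattice.mpr hz)
  obtain ⟨k, hk⟩ :=
    integral_neronScaling_of_isGloballyMinimal_holds W (C • W') D.L L₂ D.isNeronLattice hL₂ q hqmem
  have hkq : ((k : ℤ) : ℂ) = ((q : ℚ) : ℂ) := by rw [← hk, Rat.cast_intCast]
  have hk0 : ((k : ℤ) : ℂ) ≠ 0 := by rw [hkq]; exact hq
  have hα : ∀ z ∈ D.L.lattice, ((k : ℤ) : ℂ) * z ∈ L₂.lattice := fun z hz ↦ by
    rw [hkq]; exact hqmem z hz
  have hidx' : ∀ (c : ℂ) (hc : c ≠ 0), c = ((q : ℚ) : ℂ) →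
      (D.L.mulLeft c hc).lattice.toAddSubgroup.relIndex L₂.lattice.toAddSubgroup = p := by
    rintro c hc rfl
    exact hidx.trans hdeg₂
  have hidxZ : (D.L.lattice.toAddSubgroup.map (AddMonoidHom.mulLeft ((k : ℤ) : ℂ))).relIndex
      L₂.lattice.toAddSubgroup = p := by
    rw [PeriodPair.map_mulLeft_lattice_toAddSubgroup hk0]
    exact hidx' _ hk0 hkq
  -- Gealy–Klagsbrun: the isogeny changes `ord_p Δ_min`
  obtain ⟨hne, -, -⟩ := hGK W (C • W') p D.L L₂ k D.isNeronLattice hL₂ hα hidxZ hadd.1 hadd.2 hj hnpo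
  -- tame-defect invariance: `gcd(12, ord_p Δ_min)` is a class invariant, so `W₂` sits at `12 − ord_p Δ_min(W)`
  have hg := TameDefectIsogenyInvariance.gcd_padicValInt_minimalDiscriminantInt_eq_of_isIsogenous
    (W := W) (W' := C • W') (p := p) hp5 hj hiso
  obtain ⟨hadd₂, hj₂⟩ := Addv.of_isIsogenous_of_padicValRat_j_nonneg (p := p) hadd hj hiso
  have hmem₂ := padicValInt_minimalDiscriminantInt_mem_of_addv_of_padicValRat_j_nonneg (C • W') p hp5 hadd₂ hj₂
  have hv₂ : padicValInt p (C • W').minimalDiscriminantInt < 6 := by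
    rcases hmem with h | h | h <;> rcases hmem₂ with h2 | h2 | h2 | h2 | h2 | h2 | h2 <;>
      first
        | omega
        | (exfalso; rw [h, h2] at hg; norm_num at hg)
  -- E-imc-5: the optimal curve is not the starred end of this isogeny
  have h6 : padicValInt p W.minimalDiscriminantInt < 6 := hE W (C • W') D φ₂ hp.out hp5 hD hpN hdeg₂ hv₂
  omega

/-! ## §2 Stub U of skeleton v8, verbatim, from E-imc-5 at 5 and 7 and Gealy–Klagsbrun -/

/-- **`stub_optimalUnstarredNonGord57` (skeleton v8 of line `upper_anchor`, VERBATIM) ⟸ Gealy–Klagsbrun 2017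
Thm. 1 ∧ E-imc-5 `OptimalUnstarredAcrossIsogeny 5` ∧ `OptimalUnstarredAcrossIsogeny 7`.** The stub's
twist-minimality, `N > 5·10⁵` and modularity binders are idle: §1 at `p ∈ {5, 7}`. So law (U) of the C5 line
is the cell's registered conjecture E-imc-5 read at the two primes of C5 (census of E-imc-5, N < 10⁵: II–II*
255, IV–IV* 255 at 5, III–III* 62 at 7, 0 exceptions; of U, N ≤ 5·10⁵: 0 starred optimal curves on the
potentially supersingular reducible cells). Conditional result (open conjecture + cite-only fact); closes nothing.
[cite: GealyKlagsbrun2017, Thm. 1] [cite: SilvermanATAEC1994, IV Table 4.1] -/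
theorem optimalUnstarredNonGord57_of_acrossIsogeny_of_gealyKlagsbrun
    (hGK : gealyKlagsbrun2017_neronScalar_of_additive_potSupersingular)
    (hE5 : OptimalUnstarredAcrossIsogeny 5) (hE7 : OptimalUnstarredAcrossIsogeny 7) :
    exists_isNewformOf →
    ∀ (W : WeierstrassCurve ℚ) [W.IsElliptic] [W.IsGloballyMinimal] [NeZero (W.conductorNorm ℤ)]
      (D : ModularParametrizationData W (W.conductorNorm ℤ)),
      IsLatticeOptimal D → ∀ (p : ℕ) (hp : p.Prime), (p = 5 ∨ p = 7) → p ^ 2 ∣ W.conductorNorm ℤ →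
      ¬ (∃ (W' : WeierstrassCurve ℚ) (q : ℕ), W'.IsElliptic ∧ W'.IsGloballyMinimal ∧ q.Prime ∧
          q ≠ 2 ∧ q ^ 2 ∣ W.conductorNorm ℤ ∧
          IsIsogenous W (W'.quadraticTwist (((-1 : ℤ) ^ (q / 2) * q : ℤ) : ℚ)) ∧
          ¬ q ^ 2 ∣ W'.conductorNorm ℤ) →
      ¬ (∃ (W' : WeierstrassCurve ℚ) (d : ℤ), W'.IsElliptic ∧ W'.IsGloballyMinimal ∧
          (d = -1 ∨ d = 2 ∨ d = -2) ∧ 2 ^ 2 ∣ W.conductorNorm ℤ ∧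
          IsIsogenous W (W'.quadraticTwist (d : ℚ)) ∧ ¬ 2 ^ 2 ∣ W'.conductorNorm ℤ) →
      ¬ W.HasIrreducibleModPGaloisRep p →
      500000 < W.conductorNorm ℤ →
      (∀ n : ℕ, W.kodairaSymbolAt ((Rat.HeightOneSpectrum.primesEquiv (R := ℤ)).symm ⟨p, hp⟩) ≠
        .Istar n) →
      ¬ Summit.BirchSwinnertonDyer.Rank1Residual.Additive.TypeGOrd W p →
      padicValInt p W.minimalDiscriminantInt ≤ 4 := by
  intro _hnf W _ _ _ D hD p hp h57 hpN _hodd _hdy hred _hN hI hG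
  haveI : Fact p.Prime := ⟨hp⟩
  have hp5 : 5 ≤ p := by rcases h57 with rfl | rfl <;> norm_num
  have hE : OptimalUnstarredAcrossIsogeny p := by
    rcases h57 with rfl | rfl
    · exact hE5
    · exact hE7
  exact padicValInt_le_four_of_acrossIsogeny_of_gealyKlagsbrun hGK hp5 hE W D hD hpN hred hI hG

/-! ## §3 The two v8 corners of RED(57♯) modulo E-imc-5 (and Dokchitser–Dokchitser for the bi-starred one) -/

/-- **The «starred twin» corner of the Kodaira-II cell at 5 (v7 stub `stub_typeIIAtFiveCorner` = hypothesis
`hB` of p622240, VERBATIM) ⟸ Gealy–Klagsbrun ∧ E-imc-5 at 5 and 7** (the lead's μ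
`cornerTypeIIAtFive_of_optimalUnstarredNonGord`, p623176, fed with §2). Conditional result; closes nothing.
[cite: GealyKlagsbrun2017, Thm. 1] [cite: SilvermanATAEC1994, IV Table 4.1] -/
theorem typeIIAtFiveCorner_of_acrossIsogeny_of_gealyKlagsbrun
    (hGK : gealyKlagsbrun2017_neronScalar_of_additive_potSupersingular)
    (hE5 : OptimalUnstarredAcrossIsogeny 5) (hE7 : OptimalUnstarredAcrossIsogeny 7) :
    mazur_not_dvd_maninConstant_of_odd → abbesUllmo_not_dvd_maninConstant_of_not_dvd_level →
    cesnavicius_not_two_dvd_maninConstant_of_two_dvd_level → exists_isNewformOf →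
    ∀ (W : WeierstrassCurve ℚ) [W.IsElliptic] [W.IsGloballyMinimal] [NeZero (W.conductorNorm ℤ)]
      (D : ModularParametrizationData W (W.conductorNorm ℤ)),
      IsLatticeOptimal D → ∀ (p : ℕ) (hp : p.Prime), (p = 5 ∨ p = 7) → p ^ 2 ∣ W.conductorNorm ℤ →
      ¬ (∃ (W' : WeierstrassCurve ℚ) (q : ℕ), W'.IsElliptic ∧ W'.IsGloballyMinimal ∧ q.Prime ∧
          q ≠ 2 ∧ q ^ 2 ∣ W.conductorNorm ℤ ∧
          IsIsogenous W (W'.quadraticTwist (((-1 : ℤ) ^ (q / 2) * q : ℤ) : ℚ)) ∧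
          ¬ q ^ 2 ∣ W'.conductorNorm ℤ) →
      ¬ (∃ (W' : WeierstrassCurve ℚ) (d : ℤ), W'.IsElliptic ∧ W'.IsGloballyMinimal ∧
          (d = -1 ∨ d = 2 ∨ d = -2) ∧ 2 ^ 2 ∣ W.conductorNorm ℤ ∧
          IsIsogenous W (W'.quadraticTwist (d : ℚ)) ∧ ¬ 2 ^ 2 ∣ W'.conductorNorm ℤ) →
      ¬ W.HasIrreducibleModPGaloisRep p →
      500000 < W.conductorNorm ℤ →
      p ∣ D.modularDegree →
      (∀ n : ℕ, W.kodairaSymbolAt ((Rat.HeightOneSpectrum.primesEquiv (R := ℤ)).symm ⟨p, hp⟩) ≠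
        .Istar n) →
      padicValInt p W.minimalDiscriminantInt ≤ 4 →
      p = 5 → padicValInt p W.minimalDiscriminantInt = 2 →
      (∀ (W₀ : WeierstrassCurve ℚ) [W₀.IsElliptic] [W₀.IsGloballyMinimal] [NeZero (W₀.conductorNorm ℤ)]
          (D₀ : ModularParametrizationData W₀ (W₀.conductorNorm ℤ)), IsLatticeOptimal D₀ →
          IsIsogenous (W.quadraticTwist ((((-1 : ℤ) ^ (p / 2) * p : ℤ)) : ℚ)) W₀ →
          4 < padicValInt p W₀.minimalDiscriminantInt) →
      ¬ (p : ℤ) ∣ D.maninConstant :=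
  cornerTypeIIAtFive_of_optimalUnstarredNonGord
    (optimalUnstarredNonGord57_of_acrossIsogeny_of_gealyKlagsbrun hGK hE5 hE7)

/-- **The bi-starred corner (v6/v7 stub `stub_red57bistarred` = hypothesis `hB` of p617914, VERBATIM) ⟸
Dokchitser–Dokchitser 2015 Thm. 5.1 (1) ∧ Gealy–Klagsbrun ∧ E-imc-5 at 5 and 7** (the width seat's λ
`red57bistarred_of_dokchitser_of_optimalUnstarredNonGord`, p621355 §3, fed with §2 weakened by the idle
`p ∣ deg φ` binder). Conditional result; closes nothing.
[cite: DokchitserDokchitser2015LocalInvariants, Thm. 5.1 (1)] [cite: GealyKlagsbrun2017, Thm. 1] -/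
theorem red57bistarred_of_dokchitser_of_acrossIsogeny_of_gealyKlagsbrun
    (hDD : dokchitser_padicValInt_minimalDiscriminantInt_eq_of_isogeny_of_potentiallyGoodOrdinary)
    (hGK : gealyKlagsbrun2017_neronScalar_of_additive_potSupersingular)
    (hE5 : OptimalUnstarredAcrossIsogeny 5) (hE7 : OptimalUnstarredAcrossIsogeny 7) :
    mazur_not_dvd_maninConstant_of_odd → abbesUllmo_not_dvd_maninConstant_of_not_dvd_level →
    cesnavicius_not_two_dvd_maninConstant_of_two_dvd_level → exists_isNewformOf →
    ∀ (W : WeierstrassCurve ℚ) [W.IsElliptic] [W.IsGloballyMinimal] [NeZero (W.conductorNorm ℤ)]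
      (D : ModularParametrizationData W (W.conductorNorm ℤ)),
      IsLatticeOptimal D → ∀ (p : ℕ) (hp : p.Prime), (p = 5 ∨ p = 7) → p ^ 2 ∣ W.conductorNorm ℤ →
      ¬ (∃ (W' : WeierstrassCurve ℚ) (q : ℕ), W'.IsElliptic ∧ W'.IsGloballyMinimal ∧ q.Prime ∧
          q ≠ 2 ∧ q ^ 2 ∣ W.conductorNorm ℤ ∧
          IsIsogenous W (W'.quadraticTwist (((-1 : ℤ) ^ (q / 2) * q : ℤ) : ℚ)) ∧
          ¬ q ^ 2 ∣ W'.conductorNorm ℤ) →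
      ¬ (∃ (W' : WeierstrassCurve ℚ) (d : ℤ), W'.IsElliptic ∧ W'.IsGloballyMinimal ∧
          (d = -1 ∨ d = 2 ∨ d = -2) ∧ 2 ^ 2 ∣ W.conductorNorm ℤ ∧
          IsIsogenous W (W'.quadraticTwist (d : ℚ)) ∧ ¬ 2 ^ 2 ∣ W'.conductorNorm ℤ) →
      ¬ W.HasIrreducibleModPGaloisRep p →
      500000 < W.conductorNorm ℤ →
      p ∣ D.modularDegree →
      (∀ n : ℕ, W.kodairaSymbolAt ((Rat.HeightOneSpectrum.primesEquiv (R := ℤ)).symm ⟨p, hp⟩) ≠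
        .Istar n) →
      4 < padicValInt p W.minimalDiscriminantInt →
      (∀ (W₀ : WeierstrassCurve ℚ) [W₀.IsElliptic] [W₀.IsGloballyMinimal] [NeZero (W₀.conductorNorm ℤ)]
          (D₀ : ModularParametrizationData W₀ (W₀.conductorNorm ℤ)), IsLatticeOptimal D₀ →
          IsIsogenous (W.quadraticTwist ((((-1 : ℤ) ^ (p / 2) * p : ℤ)) : ℚ)) W₀ →
          4 < padicValInt p W₀.minimalDiscriminantInt) →
      ¬ (p : ℤ) ∣ D.maninConstant :=
  red57bistarred_of_dokchitser_of_optimalUnstarredNonGord hDD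
    (fun hnf W _ _ _ D hD p hp h57 hpN hodd hdy hred hN _hdeg hI hG ↦
      optimalUnstarredNonGord57_of_acrossIsogeny_of_gealyKlagsbrun hGK hE5 hE7 hnf W D hD p hp h57 hpN hodd
        hdy hred hN hI hG)

end Summit.BirchSwinnertonDyer.BirchSwinnertonDyer.Theorems

end
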